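import Mathlib
import HarnessLib
import HarnessLib.Audit
import Summits.QuantumAdvantage.Statement
import Literature.Computability.Complexity.GenericOracles
import Literature.Computability.Complexity.OracleJoin
import Literature.Computability.Complexity.Promise
import Literature.Computability.Cryptography.ClassBQP
import HarnessLib.Audit.Status.Attr

/-!
Route: GenericInertness

DORMANT since 2026-08-22T13:16:57Z (reconciler: no traction for 5.3 d (last activity item-evidence-added at 2026-08-17T04:10:42Z); parked, not closed — `ledger route dormant route-QuantumAdvantage-GenericInertness --off` to reactivate) — unstaffed, not closed; items shared with open routes are served there. `ledger route dormant <id> --off` reactivates.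

Thesis X (route GenericInertness; realises idea card generic-inertness-forcing). It suffices to show
a GENERIC-ORACLE
SEPARATION together with LANGUAGE-HELP INERTNESS:
  X = GenSep := "sufficiently generic oracles separate BQP from BPP" — for every countable family 𝒮
of sets of Cohen
  conditions there is an 𝒮-generic G with BQP^G ⊄ BPP^G;
  bridge crux LangInertness := "relative to a Cohen generic, BQP gets no help beyond unrelativized
BQP LANGUAGES" —
  ∃ countable 𝒮, ∀ 𝒮-generic G, BQP^G ⊆ ⋃_{L ∈ BQP} BPP^{G ⊕ L}.
Assembly (proved in the planner sketch, 12 lines): BPPSelfLow → LangInertness → GenSep →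
QuantumAdvantage
(if BQP ⊆ BPP then every helper L is in BPP, BPP^{G⊕L} = BPP^G by self-lowness, so BQP^G ⊆ BPP^G for
all
𝒮-generic G, contradicting GenSep at that 𝒮).
Lean (target): ∀ 𝒮 : Set (Set Literature.Computability.Complexity.CohenCondition), 𝒮.Countable → ∃
G, Literature.Computability.Complexity.IsGeneric 𝒮 G ∧ ¬
(Literature.Computability.Cryptography.BQPRel G ⊆ Literature.Computability.Complexity.BPPRel
(Literature.Computability.Complexity.Oracle.ofLanguage G)).
Calibration (items of the route): QuantumAdvantage ⇒ GenSep (PositiveTransfer, FFKL03 Lemma 4.3/Cor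
4.6, provable now);
GenSep ⇒ PromiseLift's thesis ¬(PromiseBQP ⊆ PromiseBPP') (PromiseCollapseTransfersBPP, via the NEW
inertness theorem
InertnessMachine: for a uniform family categorical over σ, L(F^G) ∈ P^{G ⊕ Π_F}, Π_F ∈ PromiseBQP,
for every G ⊇ σ).
So S ⇒ GenSep ⇒ X_PromiseLift unconditionally, and S ⟺ GenSep under LangInertness: the summit is
relocated to a
Baire-category statement whose only residue is the language/promise gap, isolated as one transfer
statement.

Rationale: WHY THIS LINE. Forcing (Cohen genericity, FFKL03 §4,§6) meets query complexity (BBBV hybrid bound,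
Nisan's s/bs/C
inequalities, Beals et al. totality bounds): relative to a Cohen generic a proper BQP machine is
categorical over a finite
condition (tree: FFKLGenericCollapse pattern), hence computes on each input a TOTAL Boolean function
of the oracle with
Q₂ ≤ T. NEW MECHANISM (this route; replaces the card's round-bound conjecture, which is FALSE for
the naive dynamics —
a trigger/decoy gadget gives exponentially many productive rounds, NOTES.md §round-bound): (a)
CERTIFICATE LEMMA: at any
revealed partial oracle ρ ⊇ σ with default completion y = ρ ∪ 0, the set ρ ∪ {δ-heavy query strings
of the run on y}
with y's values is a certificate for f(y) (a minimal sensitive block inside the disagreement set has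
≤ s(f) ≤ 16T²
elements and BBBV weight ≥ 1/(144T), so it contains a δ = 1/(2304T³)-heavy string); (b) VOTING
LEMMA: a round whose
default answer f(y_k) is wrong reveals a new variable of a fixed certificate of the true oracle, so
≤ C(f) ≤ s·bs ≤ 256T⁴
rounds are wrong and the MAJORITY over 512T⁴+1 rounds is right — no halting test, no round bound.
Heavy prefixes and
default answers are PromiseBQP questions about explicit sparse oracles, so L(F^G) ∈ P^{G ⊕ Π_F}: "a
generic oracle adds
nothing to BQP beyond PromiseBQP" (InertnessMachine). Imports: forcing/Baire category (logic),
Boolean-function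
complexity measures (combinatorics), hybrid argument (quantum query complexity). Sources:
FennerFortnowKurtzLi2003IC
(L.4.3, Cor 4.6, L.6.8, 6.16–6.18), FortnowRogers1999JCSS (Thm 4.2–4.3),
BennettBernsteinBrassardVazirani1997 (Thm 3.3),
Nisan1991, BealsEtAl2001, ImpagliazzoNaor1988, BlumImpagliazzo1987, Fortnow2001Derandomization §2,
AaronsonChen2017 L.5.3,
AaronsonIngramKretschmer2022, Goldreich2011 §6, AaronsonGurLi2026, Ko1982.
RANKED CRUXES. (2) LangInertness — the load-bearing open transfer; weaker conclusion than
PromiseLift's PL (generic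
collapse ⇐ promise collapse), hence a priori more plausible; its difficulty is approximate counting
with gap-free
(language) help. (3) InertnessMachine — the new theorem, machine level, uniform in the promise
oracle; consequences filed
as support: PromiseBQP ⊆ PromiseP ⇒ BQP^G = P^G (FFKL 6.18(2) with P = PSPACE lowered to PromiseP =
PromiseBQP) and
PromiseBQP ⊆ PromiseBPP' ⇒ BQP^G ⊆ BPP^G (so GenSep ⇒ PlThesis). (4) ClassicalInertness — prBPP =
prP ⇒ BPP^G = P^G
(FFKL 6.18(1) needs P = NP): the classical shadow, cheapest formal test of (a)+(b), of independent
derandomization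
interest (generic derandomization sits between promise and language derandomization, cf. Fortnow2001
Fig. 1).
TARGET (0) GenSep; ASSEMBLY (1); SUPPORT: PositiveTransfer (S ⇒ ∀-generic separation, FFKL L.4.3),
BPPSelfLow (Ko1982
relativized), PromiseCollapseTransfersBPP/P (genericity layer + InertnessMachine + promise-oracle
robustness).
KILL CRITERIA. (i) LangInertness shown to imply PL (stmt-0250) or to be equivalent to it ⇒ route ⊑
PromiseLift: close
superseded. (ii) InertnessMachine refuted (a categorical family whose language is not in P^{G⊕Π} for
any PromiseBQP Π)
⇒ the certificate/voting mechanism is wrong: close refuted. (iii) ClassicalInertness refuted ⇒ same.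
GenSep itself is
summit-hard (⇒ P ≠ PSPACE) and is not expected to close; its role is the relocated target.
NOT DECOMPOSED YET: BQP^G descriptions/categoricity forcing layer (copy of AWPPDescr pattern), query
weights of uniform
families on explicit table oracles, 1/poly-gap PromiseBQP amplification
(PromiseBQPWith_eq_PromiseBQP is constant-gap),
prefix search inside OracleAlg, bp(PRel) amplification for BPPSelfLow, `BPP relative to a finite
oracle = BPP'.
CONE HYGIENE (rev 2): the route file imports no `Literature.Barriers.*` module — the join G ⊕ L is
`Literature.Computability.Complexity.oracleJoin` (OracleJoin.lean) — so its import cone carries none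
of the supremacy-
catalogue named facts (yamakawa_zhandry, SampP_subset_SampBQP, SampPRel_empty, …); needs-fact: none
(every item is
stated over definitions only). Provers: take the join and its query lemmas from OracleJoin.lean and
genericity from
GenericOracles.lean; never import SupremacyTheoremsNonRelativizing*, AaronsonChenOracle or
FortnowRogersOracle for
notation only (each `_holds` link re-imports the proving Theorems module into this file).
CHEAPEST FALSIFIER. The classical voting lemma behind ClassicalInertness/InertnessMachine is
finitely checkable:
brute-force all decision trees of depth ≤ 4 on ≤ 8 variables and all hidden inputs G; if for some
tree the
reveal-the-heavy-set / default-answer dynamics answers wrongly in more than C(f) rounds, the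
certificate+voting
mechanism is dead (kill criteria ii–iii). At class level: a proof that LangInertness ⇒ PL
(stmt-QuantumAdvantage-0250)
retires the route as superseded by PromiseLift (kill criterion i).

Novelty: NOVELTY (searched 2026-08-15: lit search/hybrid/vsearch `generic oracle BPP promise', FFKL03 full
text pp.16–18/28–34 read, FR99 p.7 read, Fortnow2001 full text read, crossref for IN88 (paywalled,
acq-01390 filed), lit frontier (AaronsonGurLi2026), remote APIs 429; card graded new-combination by
refuter-novelty-audit 2026-08-15). Nearest prior art: (1) doi:10.1016/s0890-5401(03)00018-x
FennerFortnowKurtzLi2003IC §6.5 L.6.16–6.18: C^G ⊆ P^{G ⊕ F_j} by the Standard Algorithm with a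
Σ₂-type certificate FINDER (ImpagliazzoNaor1988: F_j ∈ FP^{Σ₂^C}; FPSPACE for AWPP/BQP), whence
BPP^G = P^G needs P = NP and BQP^G = P^G needs P = PSPACE; Lemma 4.3/Cor 4.6 (positive transfer).
(2) arXiv:cs/9811023 FortnowRogers1999JCSS Thm 4.2: BBBV heavy set enumerated with PSPACE help for
SPARSE (UP∩coUP) generics. (3) arXiv:1612.05903 AaronsonChen2017 L.5.3 and arXiv:2111.10409
AaronsonIngramKretschmer2022: iterated heavy-query learning with TQBF help, rounds bounded by
sparsity/randomness. (4) doi:10.1109/ccc.2001.933869 Fortnow2001 §2: generic over TQBF has P = BPP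
but Promise-BPP hard (the only recorded link between promise derandomization and generics). (5)
In-tree twin for RANDOM oracles: route RandomOracleGauge (AA14 Thm 7(iii) with P = P^#P lowered to a
promise collapse, conditional on the AA conjecture). DELTA: (a) certificate-by-heavy-set lemma
(minimal sensitive block ≤ s(f) + BBBV) replaces certificate SEARCH by additive approximate
counting; (b) majority VOTING over 512T⁴+1 rounds rep  [refs: 10.1016/s0890-5401(03, 10.1109/ccc.2001.933869, cs/9811023, 1612.05903, 2111.10409, doi:10.1016/s0890-5401, doi:10.1109/ccc.2001.933869, AaronsonGurLi2026, ImpagliazzoNaor1988, AaronsonChen2017, AaronsonIngramKretschmer2022]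

Barriers (technique_class: generic-oracles, black-box, relativizing, class-separation): Literature.Barriers.QuantumAdvantage.Relativization: APPLIES to the target GenSep (a class
separation: GenSep ⇒ PlThesis ⇒ PP ⊄ BPP) and is NOT evaded — the route supplies no separation
technique; all earned items (InertnessMachine, ClassicalInertness, transfers) are
SIMULATION/TRANSFER theorems that themselves relativize to any base oracle B (consistently: over a
PSPACE-complete B both sides collapse, = the Fortnow–Rogers world), cf.
Relativization.not_relativizes_either.
Literature.Barriers.QuantumAdvantage.Algebrization: as Relativization for GenSep; no arithmetization
is used; silent on the transfer items (Algebrization.summary untouched).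
Literature.Barriers.QuantumAdvantage.RandomOracleMethod: generic ≠ random: fortnowRogers1999_thm44 /
aaronsonAmbainis2014_thm7iii are the measure-one analogues (route RandomOracleGauge); here
categoricity (a Baire-category phenomenon) replaces `most oracles' and no AA-type conjecture is
needed; we make no measure claim.
Literature.Barriers.QuantumAdvantage.SupremacyTheoremsNonRelativizing: consistent and predicted —
fortnowRogers1999_cor37's world H ⊕ G is PromiseCollapseTransfersP rerelativized to a
PSPACE-complete H; promise/sampling advantage survives there while language advantage dies, which is
exactly why the residue of the route is the language-help crux LangInertness.
Literature.Barriers.QuantumAdvantage.TotalFunctionSpeedupLimit: used as a RESOURCE, not fought —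
categorical ⇒ total f_x ⇒ bs ≤ 16T², C ≤ s·bs (bealsEtAl2001_thm54

Novelty grade: new-combination — Route review grade (refuter, 2026-08-15). Search this session: crossref 'generic oracles BPP P derandomization promise Impagliazzo Naor' (IN88, BI87, CIY97, Impagliazzo–Wigderson; no paper stating 'prBPP=prP ⇒ BPP^G=P^G for Cohen generics' or a heavy-set-certificate + majority-voting version of the  (refuter refuter-rreview-route-AnomalousDissipati-218e94b9-0, 2026-08-15T11:21:38Z; prior: doi:10.1016/s0890-5401(03)00018-x FennerFortnowKurtzLi2003IC §6.5 L.6.16–6.18 (C^G ⊆ P^{G⊕F_j}, certificate FINDER with Σ₂/PSPACE help), L.4.3/Cor 4.6, doi:10.1109/sct.1988.5260 ImpagliazzoNaor1988 (full text pending acq-01390); doi:10.1109/sfcs.1987.30 BlumImpagliazzo1987, arXiv:cs/9811023 FortnowRogers1999JCSS Thm 4.2; arXiv:1612.05903 AaronsonChen2017 L.5.3; arXiv:2111.10409 AaronsonIngramKrets)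

History (route lifecycle, newest last):
- 2026-08-15T16:12:41Z · rev 2: restated LangInertness (stmt-QuantumAdvantage-1824), InertnessMachine (stmt-QuantumAdvantage-1825), BPPSelfLow (stmt-QuantumAdvantage-1830) — route-repair (glue + cone): (1) DECIDING THEOREM `closes : BPPSelfLow → LangInertness → GenSep → QuantumAdvantage` (11 tactic lines, axioms propext/Classical.ch (planner-rbadge-QuantumAdvantage-GenericInertne-44b20738-g4-0)
- 2026-08-16T04:14:58Z · AUTO-CRUX (backfill): GenSep — hypotheses of the deciding theorem that nothing in the route derives are cruxes (operator:999:1085951)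
- 2026-08-22T13:16:57Z · DORMANT — reconciler: no traction for 5.3 d (last activity item-evidence-added at 2026-08-17T04:10:42Z); parked, not closed — `ledger route dormant route-QuantumAdvantage (operator:999:85288)

sub-problem: QuantumAdvantage · status: dormant · opened planner-plancard-QuantumAdvantage-QuantumAdva-ccedb03a-0 2026-08-15T10:59:06Z · rev 2 · ledger route-QuantumAdvantage-GenericInertness
GENERATED by the gate from the ledger (D-0016/17). Provers cite these decls: `theorem foo : Summit.QuantumAdvantage.QuantumAdvantage.Theses.GenericInertness.<Decl> := …` in Summits/QuantumAdvantage/QuantumAdvantage/Theorems/<Name>.lean.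
-/

namespace Summit.QuantumAdvantage.QuantumAdvantage.Theses.GenericInertness

open scoped BigOperators Topology Manifold Classical MeasureTheory ProbabilityTheory Matrix InnerProductSpace ComplexConjugate ContinuousMap
open Filter Set Function TopologicalSpace MeasureTheory

attribute [summit_statement] _root_.QuantumAdvantage

open Literature.QuantumAdvantage

/-- item stmt-QuantumAdvantage-1823 · crux (kind.auto-crux: conjecture-grade) · rank 0 · open · by planner
why it might fail: False if P = PSPACE (FFKL03 p.33 Thm 6.18(2): BQP^G = P^G for every Cohen generic G); GenSep ⇒ ¬(PromiseBQP ⊆ PromiseBPP') ⇒ PP ⊄ BPP ⇒ P ≠ PSPACE, so closing it needs a non-relativizing class-separation idea exactly as the summit does — relocated target, do not attempt directly.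
sources: FennerFortnowKurtzLi2003IC, FortnowRogers1999JCSS, BlumImpagliazzo1987, Literature.Barriers.QuantumAdvantage.SeparationPrerequisites, Literature.Barriers.QuantumAdvantage.fennerFortnowKurtzLi2003_thm618_awpp
TARGET X of route GenericInertness: SUFFICIENTLY GENERIC ORACLES SEPARATE BQP FROM BPP — for every
countable family 𝒮 of sets of Cohen conditions some 𝒮-generic oracle G has BQP^G ⊄ BPP^G (tree
models: CohenCondition/IsGeneric of GenericOracles.lean, BQPRel = uniform Clifford+T families with
XOR oracle gates, BPPRel = bp(PRel)). Calibration: NECESSARY for the summit — QuantumAdvantage ⇒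
GenSep by PositiveTransfer (FFKL03 Lemma 4.3/Cor 4.6: an oracle-independent L ∈ BQP∖BPP stays
outside BPP^G) plus exists_isGeneric on 𝒮 ∪ 𝒮₀; SUFFICIENT given the bridge crux LangInertness
(Assembly). GenSep ⇒ PromiseLift.PlThesis ¬(PromiseBQP ⊆ PromiseBPP') by
PromiseCollapseTransfersBPP, hence GenSep ⇒ PP ⊄ BPP, P ≠ PSPACE (SeparationPrerequisites); FFKL03
Thm 6.18(2): P = PSPACE ⇒ BQP^G = P^G for every Cohen generic, so GenSep is false if P = PSPACE. So
S ⇒ GenSep ⇒ X_PromiseLift unconditionally and S ⟺ GenSep under LangInertness.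
[FennerFortnowKurtzLi2003IC §4 L.4.3–Cor 4.7, §6.5 Thm 6.18; FortnowRogers1999JCSS §2.6;
BlumImpagliazzo1987] -/
@[route_item "route-QuantumAdvantage-GenericInertness", crux]
def GenSep : Prop :=
  ∀ 𝒮 : Set (Set Literature.Computability.Complexity.CohenCondition), 𝒮.Countable → ∃ G : Language Bool, Literature.Computability.Complexity.IsGeneric 𝒮 G ∧ ¬ (Literature.Computability.Cryptography.BQPRel G ⊆ Literature.Computability.Complexity.BPPRel (Literature.Computability.Complexity.Oracle.ofLanguage G))

-- earlier LangInertness (stmt-QuantumAdvantage-1824, replaced 2026-08-15T16:12:41Z -> stmt-QuantumAdvantage-10361): retired by None — ∃ 𝒮 : Set (Set Literature.Computability.Complexity.CohenCondition), 𝒮.Countable ∧ ∀ G : Language Bool, Literature.Computability.Complexity.IsGeneric 𝒮 G → Literature.Computability.Cryptography.BQPRel G ⊆ ⋃ L ∈ Literature.Computability.Cryptography.BQP, Literature.Comp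
/-- item stmt-QuantumAdvantage-10361 · crux · rank 2 · open · by planner
why it might fail: Trading InertnessMachine's PROMISE help Π ∈ PromiseBQP for ONE BQP LANGUAGE is a `PromiseBQP ⊆ BPP^BQP?'-type open gap: δ-heavy-query finding is additive approximate counting and a language helper must be proper at gap-less thresholds (prBPP-vs-BPP obstruction); ¬LangInertness ⇒ P ≠ PSPACE.
sources: Goldreich2011, AaronsonGurLi2026, AaronsonArkhipov2013, Aaronson2010, FennerFortnowKurtzLi2003IC, Fortnow2001Derandomization
BRIDGE CRUX (rank 2, the load-bearing open transfer): LANGUAGE-HELP INERTNESS — there is a countable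
family 𝒮 of sets of Cohen conditions such that for every 𝒮-generic G, BQP^G ⊆ ⋃_{L ∈ BQP} BPP^{G ⊕
L} (oracleJoin: 0w ↦ G, 1w ↦ L): relative to a Cohen generic, quantum polynomial time gets nothing
that classical polynomial time with the same generic and ONE unrelativized BQP LANGUAGE cannot get.
With BQP ⊆ BPP every helper L is in BPP and BPP^{G⊕L} = BPP^G (BPPSelfLow), so LangInertness ⇒ (¬S ⇒
generic collapse); since generic collapse is IMPLIED BY the promise collapse PromiseBQP ⊆
PromiseBPP' (PromiseCollapseTransfersBPP), LangInertness has a weaker conclusion than PromiseLift's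
PL (stmt-0250: ¬S ⇒ promise collapse) and is a priori more plausible; it holds if P = PSPACE (then
BQP^G = P^G, FFKL03 6.18(2)). Line of attack: InertnessMachine gives BQP^G ⊆ P^{G ⊕ Π}, Π ∈
PromiseBQP; it remains to replace the PROMISE oracle by a LANGUAGE oracle, i.e. to find the δ-heavy
query strings of an explicit oracle-free circuit (an additive approximate-counting task) with
gap-free help — candidate tools: pseudo-deterministic heavy-hitter finding (AaronsonGurLi2026 Thm
1.7: pd-quantum search = P- -/
@[route_item "route-QuantumAdvantage-GenericInertness", crux]
def LangInertness : Prop :=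
  ∃ 𝒮 : Set (Set Literature.Computability.Complexity.CohenCondition), 𝒮.Countable ∧ ∀ G : Language Bool, Literature.Computability.Complexity.IsGeneric 𝒮 G → Literature.Computability.Cryptography.BQPRel G ⊆ ⋃ L ∈ Literature.Computability.Cryptography.BQP, Literature.Computability.Complexity.BPPRel (Literature.Computability.Complexity.Oracle.ofLanguage (Literature.Computability.Complexity.oracleJoin G L))

-- earlier InertnessMachine (stmt-QuantumAdvantage-1825, replaced 2026-08-15T16:12:41Z -> stmt-QuantumAdvantage-10362): retired by None — ∀ F : Literature.Computability.Cryptography.QCircuitFamily Literature.Computability.Cryptography.cliffordT, F.IsUniform → ∀ σ : Literature.Computability.Complexity.CohenCondition, (∀ Z : Language Bool, σ.ExtendedBy Z → ∀ x : List Bool, F.acceptProbOn Z x ≤ 1 / 3 ∨ 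
/-- item stmt-QuantumAdvantage-10362 · crux · rank 3 · open · by planner
why it might fail: Unrefereed new argument (heavy ∪ revealed = certificate via minimal block ≤ s ≤ 16T² + BBBV; ≤ C(f) ≤ 256T⁴ wrong rounds; majority). As STATED: 1/poly-gap weight thresholds must sit in constant-gap PromiseBQP (amplify + uniform reversible lookup of ρ_k); ONE IsPolyTime OracleAlg runs descent+vote.
sources: FennerFortnowKurtzLi2003IC, FortnowRogers1999JCSS, BennettBernsteinBrassardVazirani1997, Nisan1991, BealsEtAl2001, AaronsonChen2017
CRUX (rank 3, the route's NEW THEOREM, provable-now candidate): GENERIC INERTNESS AT MACHINE LEVEL —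
for every uniform Clifford+T oracle family F and Cohen condition σ over which F is CATEGORICAL
(acceptance probability ∉ (1/3,2/3) on every input for EVERY oracle extending σ) there are a promise
problem Q ∈ PromiseBQP and ONE deterministic polynomial-time oracle machine M that, for EVERY
language O separating Q (Q.yes ⊆ O, Q.no ∩ O = ∅) and EVERY G ⊇ σ, decides x ↦ [acc_F^G(x) ≥ 2/3]
relative to G ⊕ O with polynomially long queries: L(F^G) ∈ P^{G ⊕ Q}, uniformly in the promise
oracle. PROOF PLAN (certificate + voting; no round bound): on input x (T = #oracle gates of F.circ
|x|) keep a revealed finite partial oracle ρ_k ⊇ σ∩G (ρ_0 = σ), default completion y_k = ρ_k ∪ 0.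
Round k: (i) by prefix descent with Q-queries `total query weight of the run of F on (x, y_k) on
strings with prefix p outside dom ρ_k is ≥ θ (YES) / ≤ θ/2 (NO)', θ = δ = 1/(2304 T³), find S_k ⊇
H_k := {unrevealed δ-heavy strings} (|explored| ≤ 4T/θ per level); (ii) ask Q for b_k :=
[acc_F^{y_k}(x) ≥ 2/3] (on-promise by categoricity, ρ_k ⊇ σ); (iii) reveal G on S_k. Output MAJORITY
of b_0..b_P, P = 512 T⁴. CERTIFICA -/
@[route_item "route-QuantumAdvantage-GenericInertness"]
def InertnessMachine : Prop :=
  ∀ F : Literature.Computability.Cryptography.QCircuitFamily Literature.Computability.Cryptography.cliffordT, F.IsUniform → ∀ σ : Literature.Computability.Complexity.CohenCondition, (∀ Z : Language Bool, σ.ExtendedBy Z → ∀ x : List Bool, F.acceptProbOn Z x ≤ 1 / 3 ∨ 2 / 3 ≤ F.acceptProbOn Z x) → ∃ Q ∈ Literature.Computability.Cryptography.PromiseBQP, ∃ M : Literature.Computability.Complexity.OracleAlg Bool, M.IsPolyTime Computability.encodingBoolBool ∧ ∃ q : Polynomial ℕ, ∀ O : Language Bool, Q.yes ≤ O → Q.no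 ≤ Oᶜ → ∀ G : Language Bool, σ.ExtendedBy G → ∀ x : List Bool, (∃ b : Bool, M.run (Literature.Computability.Complexity.Oracle.ofLanguage (Literature.Computability.Complexity.oracleJoin G O)) (q.eval x.length) x = some b ∧ (b = true ↔ 2 / 3 ≤ F.acceptProbOn G x)) ∧ ∀ y ∈ M.queries (Literature.Computability.Complexity.Oracle.ofLanguage (Literature.Computability.Complexity.oracleJoin G O)) (q.eval x.length) x, y.length ≤ q.eval x.length

/-- item stmt-QuantumAdvantage-1826 · crux · rank 4 · open · by planner
why it might fail: Unrecorded: FFKL03 p.33 L.6.17/Thm 6.18(1) (after IN88) get BPP^G = P^G only from P = NP (FP^Σ₂ certificate finder); Fortnow2001 §2 has no arrow `prBPP easy ⇒ generic collapse': new, or subtly known (IN88 pending acq-01390). As stated: heavy-prefix thresholds must be PromiseBPP'-uniform in ρ_k.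
sources: FennerFortnowKurtzLi2003IC, ImpagliazzoNaor1988, ImpagliazzoKabanetsWigderson2002, Fortnow2001Derandomization, BlumImpagliazzo1987, Nisan1991
CRUX (rank 4, classical shadow; cheapest formal test of the certificate+voting mechanism, of
independent derandomization interest): prBPP = prP (textbook promise classes: PromiseBPP' ⊆ PromiseP
= promiseLift P) ⇒ for all sufficiently generic G, BPP^G = P^G (⊆ stated; ⊇ is
PRel_subset_BPPRel_holds). FFKL03 Thm 6.18(1) obtains BPP^G = P^G from P = NP (certificate finder
F_j ∈ FP^{Σ₂ᵖ}, ImpagliazzoNaor1988); Fortnow2001Derandomization Fig. 1/§2 places `Promise-BPP easy'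
(Hypothesis III) strictly between P = NP and P = BPP and records only the IN88 world (generic over
TQBF: P = BPP, III fails). CLAIM here: Hypothesis III already forces the generic collapse, so `BPP^G
= P^G for Cohen generics' is sandwiched: prBPP = prP ⇒ (∀ generic G, BPP^G = P^G) ⇒ BPP = P (last
step: FFKL Lemma 4.3). PROOF PLAN: as InertnessMachine with a categorical bp(P^·)-description (M,
coins p) in place of F: f_x total with R(f_x) ≤ T, weights m_i(y) = E[#queries to i], heavy δ =
1/(27T) (minimal block ≤ s ≤ bs ≤ 3R [Nisan1991]; Pr[run on y_k touches B] ≥ 1/3); wrong rounds ≤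
C(f) ≤ s·bs ≤ 9T²; majority over 18T²+1 rounds; heavy prefixes and default answers are prBPP
questions about explicit table oracles, answe -/
@[route_item "route-QuantumAdvantage-GenericInertness"]
def ClassicalInertness : Prop :=
  Literature.Computability.Complexity.PromiseBPP' ⊆ Literature.Computability.Complexity.PromiseP → ∃ 𝒮 : Set (Set Literature.Computability.Complexity.CohenCondition), 𝒮.Countable ∧ ∀ G : Language Bool, Literature.Computability.Complexity.IsGeneric 𝒮 G → Literature.Computability.Complexity.BPPRel (Literature.Computability.Complexity.Oracle.ofLanguage G) ⊆ Literature.Computability.Complexity.PRel (Literature.Computability.Complexity.Oracle.ofLanguage G)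

-- earlier BPPSelfLow (stmt-QuantumAdvantage-1830, replaced 2026-08-15T16:12:41Z -> stmt-QuantumAdvantage-10363): retired by None — ∀ G L : Language Bool, L ∈ Literature.Computability.Complexity.BPP → Literature.Computability.Complexity.BPPRel (Literature.Computability.Complexity.Oracle.ofLanguage (Literature.Barriers.QuantumAdvantage.oracleJoin G L)) ⊆ Literature.Computability.Complexity.BPPRel (Lit
/-- item stmt-QuantumAdvantage-10363 · support · rank 9 · open · by planner
sources: Ko1982
SUPPORT (hypothesis of the Assembly; in print, relativizing): BPP is self-low relative to any oracle
— L ∈ BPP ⇒ BPP^{G ⊕ L} ⊆ BPP^G for every G (Ko1982; Zachos: BPP^BPP = BPP). Proof in the tree's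
bp(PRel) model: amplify the outer bp(P^{G⊕L}) witness to error ≤ 1/12 (majority of O(1) independent
coin blocks) and the BPP algorithm for L to error ≤ 1/(12 q(n)) (majority of O(log q) blocks),
answer each of the ≤ q(n) L-queries of the P^{G⊕L} machine by the amplified algorithm on fresh coin
blocks; union bound: error ≤ 1/12 + 1/12 < 1/3; the combined verdict language is in P^G (OracleAlg
composition, PRel_closed_boolUnpair_fst / Cook-closure patterns) with coins of polynomial length.
[Ko1982; BennettGill1981 §1; AroraBarak2009 §7.5 (error reduction)] [rev 2, cone repair: the join G
⊕ L is now the light `Literature.Computability.Complexity.oracleJoin` (OracleJoin.lean; imports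
Mathlib.Computability.Language + Complexity.Oracle only), rfl-equal to the barrier-catalogue
`Literature.Barriers.QuantumAdvantage.oracleJoin` it replaces (DefeqCheck.lean rc 0) — meaning
unchanged.] -/
@[route_item "route-QuantumAdvantage-GenericInertness", crux]
def BPPSelfLow : Prop :=
  ∀ G L : Language Bool, L ∈ Literature.Computability.Complexity.BPP → Literature.Computability.Complexity.BPPRel (Literature.Computability.Complexity.Oracle.ofLanguage (Literature.Computability.Complexity.oracleJoin G L)) ⊆ Literature.Computability.Complexity.BPPRel (Literature.Computability.Complexity.Oracle.ofLanguage G)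

/-- item stmt-QuantumAdvantage-1827 · support · rank 9 · open · by planner
sources: FennerFortnowKurtzLi2003IC, Fortnow2001Derandomization
SUPPORT (closed form consumed by other routes; GenSep ⇒ PromiseLift.PlThesis is its contrapositive):
PromiseBQP ⊆ PromiseBPP' ⇒ ∃ countable 𝒮, ∀ 𝒮-generic G, BQP^G ⊆ BPP^G. Proof from InertnessMachine:
(1) genericity layer exactly as FFKLGenericCollapse.lean (descriptions = uniform families F;
requirement `F proper at G everywhere → L(F,G) ∈ BPP^G'; a violation of properness below τ is forced
by a finite extension since acc_F^Z(x) reads finitely many strings; otherwise F is categorical over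
τ and τ forces the requirement by (2)); (2) for categorical F take Q, M from InertnessMachine, a
textbook-prBPP algorithm (L' ∈ P, coins p) for Q from the hypothesis, amplify it to error
2^{-q(n)-2} and answer M's O-queries with it: with probability ≥ 3/4 over the coins all polynomially
many on-promise answers are those of SOME separator O (off-promise answers are arbitrary but M is
correct for every separator — lazily fix them), so x is decided with error ≤ 1/4 < 1/3: L(F^G) ∈
bp(P^G) = BPPRel. Cohen-generic twin of RandomOracleGauge.PromiseTransfer (there the AA conjecture
is load-bearing; here categoricity makes the transfer unconditional). [FennerFortnowKurtzLi2003IC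
L.6.8, §6.5; Goldreich20 -/
@[route_item "route-QuantumAdvantage-GenericInertness"]
def PromiseCollapseTransfersBPP : Prop :=
  Literature.Computability.Cryptography.PromiseBQP ⊆ Literature.Computability.Complexity.PromiseBPP' → ∃ 𝒮 : Set (Set Literature.Computability.Complexity.CohenCondition), 𝒮.Countable ∧ ∀ G : Language Bool, Literature.Computability.Complexity.IsGeneric 𝒮 G → Literature.Computability.Cryptography.BQPRel G ⊆ Literature.Computability.Complexity.BPPRel (Literature.Computability.Complexity.Oracle.ofLanguage G)

/-- item stmt-QuantumAdvantage-1828 · support · rank 9 · open · by planner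
sources: FennerFortnowKurtzLi2003IC, FortnowRogers1999JCSS
SUPPORT: PromiseBQP ⊆ PromiseP ⇒ ∃ countable 𝒮, ∀ 𝒮-generic G, BQP^G ⊆ P^G (hence = ,
PRel_ofLanguage_subset_BQPRel_holds) — FFKL03 Thm 6.18(2) for BQP with the hypothesis P = PSPACE
LOWERED to PromiseP = PromiseBQP (P = PSPACE ⇒ PromiseBQP ⊆ promiseLift PSPACE = PromiseP). Proof:
genericity layer as in PromiseCollapseTransfersBPP + InertnessMachine with O := the P-language
separating Q given by the hypothesis (promiseLift P), and P^{G ⊕ O} ⊆ P^G for O ∈ P (answer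
O-queries in line; Cook-closure mem_PRel_of_polyTimeTuringReducible_holds pattern). Rerelativized to
a PSPACE-complete B this is the BQP half of fennerFortnowKurtzLi2003_thm618_awpp / the
Fortnow–Rogers world. [FennerFortnowKurtzLi2003IC Thm 6.18(2), pp. 33–34; FortnowRogers1999JCSS Thm
3.6, Cor 3.7] -/
@[route_item "route-QuantumAdvantage-GenericInertness"]
def PromiseCollapseTransfersP : Prop :=
  Literature.Computability.Cryptography.PromiseBQP ⊆ Literature.Computability.Complexity.PromiseP → ∃ 𝒮 : Set (Set Literature.Computability.Complexity.CohenCondition), 𝒮.Countable ∧ ∀ G : Language Bool, Literature.Computability.Complexity.IsGeneric 𝒮 G → Literature.Computability.Cryptography.BQPRel G ⊆ Literature.Computability.Complexity.PRel (Literature.Computability.Complexity.Oracle.ofLanguage G)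

/-- item stmt-QuantumAdvantage-1829 · support · rank 9 · open · by planner
sources: FennerFortnowKurtzLi2003IC, BlumImpagliazzo1987
SUPPORT (provable now; shows GenSep is NECESSARY for S): QuantumAdvantage ⇒ ∃ countable 𝒮, ∀
𝒮-generic G, BQP^G ⊄ BPP^G. Proof (FFKL03 Lemma 4.3/4.5, Blum–Impagliazzo): take L ∈ BQP ∖ BPP; L ∈
BQP ⊆ BQP^G (BQP_subset_BQPRel). For each bp(P^·)-description Δ = (polynomial-time OracleAlg M, fuel
q, coins p) let Bad_Δ(Z) := `Δ is proper at Z on every input and its language at Z is L'; the set of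
conditions forcing ¬Bad_Δ is DENSE: given τ, either some Z ⊇ τ and x witness improperness or an
error at x — both read finitely many strings of Z, so a finite extension of τ forces it — or Δ
decides L correctly relative to EVERY Z ⊇ τ, in particular relative to the finite language τ⁻¹(1),
whence L ∈ BPP^{finite} = BPP (hard-wire the table; PRel of a finite oracle = P, cf.
OracleEmpty.lean PRel_empty_holds), contradiction. 𝒮 := these countably many forcing sets
(countable_polyTimeOracleAlg_holds); an 𝒮-generic G meets each, so no Δ witnesses L ∈ BPP^G.
[FennerFortnowKurtzLi2003IC L.4.3, L.4.5, Cor 4.6 (p. 17–18); BlumImpagliazzo1987] -/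
@[route_item "route-QuantumAdvantage-GenericInertness"]
def PositiveTransfer : Prop :=
  QuantumAdvantage → ∃ 𝒮 : Set (Set Literature.Computability.Complexity.CohenCondition), 𝒮.Countable ∧ ∀ G : Language Bool, Literature.Computability.Complexity.IsGeneric 𝒮 G → ¬ (Literature.Computability.Cryptography.BQPRel G ⊆ Literature.Computability.Complexity.BPPRel (Literature.Computability.Complexity.Oracle.ofLanguage G))

/-- item stmt-QuantumAdvantage-1831 · assembly · rank 1 · open · by planner
sources: FennerFortnowKurtzLi2003IC
ASSEMBLY (pure logic, PROVED in the planner's Sketch.lean, 12 lines): BPPSelfLow → LangInertness →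
GenSep → QuantumAdvantage. By contradiction: ¬QuantumAdvantage gives BQP ⊆ BPP; take 𝒮 from
LangInertness and an 𝒮-generic G with BQP^G ⊄ BPP^G from GenSep; every K ∈ BQP^G lies in BPP^{G ⊕ L}
for some L ∈ BQP ⊆ BPP, hence in BPP^G by BPPSelfLow — contradiction. -/
@[route_item "route-QuantumAdvantage-GenericInertness"]
def Assembly : Prop :=
  BPPSelfLow → LangInertness → GenSep → QuantumAdvantage

/-! D-0027 §2.1 — DECIDING THEOREM (planner-authored via `route open/edit --closes-file`; by planner-rbadge-QuantumAdvantage-GenericInertne-44b20738-g4-0 2026-08-15T16:12:41Z):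
its hypotheses are this route's items and its conclusion the sub-problem Statement (glue_lint), and it elaborates with this file. -/

@[closes "route-QuantumAdvantage-GenericInertness"] theorem closes : BPPSelfLow → LangInertness → GenSep → QuantumAdvantage := by
  intro hLow hInert hSep
  by_contra hS
  obtain ⟨𝒮, h𝒮c, h𝒮⟩ := hInert
  obtain ⟨G, hG, hnot⟩ := hSep 𝒮 h𝒮c
  refine hnot fun K hK => ?_
  obtain ⟨L, hL, hKL⟩ := Set.mem_iUnion₂.mp (h𝒮 G hG hK)
  have hLBPP : L ∈ Literature.Computability.Complexity.BPP := by
    by_contra hLn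
    exact hS ⟨L, hL, hLn⟩
  exact hLow G L hLBPP hKL

end Summit.QuantumAdvantage.QuantumAdvantage.Theses.GenericInertness
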